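import Mathlib
import Summits.AtomisticToContinuum.HydrodynamicLimit.Theorems.ImplosionDichotomyDenseExcursionCavityMatching
import Summits.AtomisticToContinuum.HydrodynamicLimit.Theorems.ImplosionDichotomyDenseExcursionSonicSmoothBranchGapChar

/-!
# Pointwise existence of the smooth centre-regular resolvent solution off the integral Frobenius exponents (theorem T6b)
# (crux `DenseExcursion`, line `sonic-cavity-renewal`, bricks for stub `stub_cavityResolventCk`)

Helper file (`--supports stmt-AtomisticToContinuum-12586`, line lead a2, stub-worker E1 for `stub_cavityResolventCk`,
theorem T6 of its decomposition). Registered helpers: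

* `sonic_smooth_branch_gap` — THE SMOOTH BRANCH AT THE REPULSIVE SONIC POINT IN RESOLVENT FORM UNDER A QUANTIFIED GAP:
  for a monatomic tube profile, `k : ℕ`, a bound `R` and a gap `μ > 0` there is `δ > 0` such that for every `Λ` with
  `‖Λ‖ ≤ R`, `Re ν(Λ) ≤ k − 1` and `‖n ∓ ν(Λ)‖ ≥ μ` for all `n : ℕ` (`ν(Λ) = (b₊₊(0) − Λ)/κ` the Frobenius exponent),
  every pair of `C^∞` sources and every `q₀`, the resolvent equation `Λŵ − linW = f`, `Λŝ − linS = g` has a `C^∞`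
  solution on `(−δ, δ)` with `ŵ(0) − 3ŝ(0) = q₀` (`sonic_char_branch_gap` read through the characteristic fields
  `p = ŵ + 3ŝ`, `q = ŵ − 3ŝ`, `lin_iff_char`);
* `exists_gap_of_forall_ne_int` — an exponent `ν ∉ ℤ` has a positive gap `‖n ∓ ν‖ ≥ μ` (`n : ℕ`);
* `cavity_resolvent_of_local` — ON THE WHOLE REGION `Re Λ ≥ −1/5` OUTSIDE THE THREE DISCS, LOCAL SONIC DATA GIVE THE
  GLOBAL SOLUTION: the matching alternative `cavity_matching_alternative` plus exclusivity (`rate_eq_of_window`: a smooth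
  radial mode at `Λ` forces `Λ ∈ {Λ₁, r, 0}`, excluded by the discs);
* `cavity_resolvent_pointwise_nonint` (T6b) — POINTWISE EXISTENCE FOR EVERY `Λ` OF THE REGION WHOSE FROBENIUS EXPONENT
  IS NOT AN INTEGER (in particular every real `Λ ∈ [−1/5, ∞)` off the discs and off the discrete set
  `{b₊₊(0) − mκ : m ∈ ℤ}`, and every non-real `Λ`): for every regular source there is a smooth centre-regular solution
  of the resolvent equation on `ℝ`. What remains of T6 after this file: the integral exponents `ν(Λ) = m ∈ ℤ` — the jet
  resonances `m ∈ {0, 1, 2, 3}` (Frobenius structure with a compatibility condition) and the apparent resonances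
  `m ≤ −1` of the second Frobenius branch (where the smooth branch needs no Taylor subtraction) — for which
  `cavity_resolvent_of_local` reduces the claim to the local existence of a non-trivial smooth homogeneous solution and
  of smooth particular solutions on some `(−δ, δ)`.

Sources: folklore (Coddington–Levinson 1955 Ch. 4; Evans-function matching). Everything proved; no new definitions.
-/

noncomputable section

open Set Filter
open scoped Topology ContDiff

namespace Summit.AtomisticToContinuum.HydrodynamicLimit.Theorems.SonicCavityRenewal

open Summit.AtomisticToContinuum.HydrodynamicLimit.Theorems.R2OneModeTwoConditions

/-! ## The smooth branch at the sonic point in resolvent form, under a gap -/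

/-- **Registered helper `sonic_smooth_branch_gap`: THE SMOOTH BRANCH AT THE REPULSIVE SONIC POINT UNDER A QUANTIFIED GAP,
IN RESOLVENT FORM.** See the module docstring. [folklore] -/
theorem sonic_smooth_branch_gap : ∀ (r : ℝ) (W S : ℝ → ℝ), IsMonatomicProfile r W S → CavityTube r W S → ∀ (k : ℕ) (R μ : ℝ), 0 < μ → ∃ δ > 0, ∀ Λ : ℂ, ‖Λ‖ ≤ R → ((((2 / 3 * deriv W 0 + 2 * deriv S 0 + 2 * W 0 + 4 * S 0 - r : ℝ) : ℂ) - Λ) / ((-(deriv W 0 + deriv S 0) : ℝ) : ℂ)).re ≤ (k : ℝ) - 1 → (∀ n : ℕ, μ ≤ ‖(n : ℂ) - ((((2 / 3 * deriv W 0 + 2 * deriv S 0 + 2 * W 0 + 4 * S 0 - r : ℝ) : ℂ) - Λ) / ((-(deriv W 0 + deriv S 0) : ℝ) : ℂ))‖ ∧ μ ≤ ‖(n : ℂ) + ((((2 / 3 * deriv W 0 + 2 * deriv S 0 + 2 * W 0 + 4 * S 0 - r : ℝ) : ℂ) - Λ) / ((-(deriv W 0 + deriv S 0) : ℝ) : ℂ))‖)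 → ∀ (f g : ℝ → ℂ), ContDiff ℝ ∞ f → ContDiff ℝ ∞ g → ∀ q₀ : ℂ, ∃ ŵ ŝ : ℝ → ℂ, ContDiffOn ℝ ∞ ŵ (Set.Ioo (-δ) δ) ∧ ContDiffOn ℝ ∞ ŝ (Set.Ioo (-δ) δ) ∧ ŵ 0 - 3 * ŝ 0 = q₀ ∧ ∀ x ∈ Set.Ioo (-δ) δ, Λ * ŵ x - linW r W S ŵ ŝ x = f x ∧ Λ * ŝ x - linS r W S ŵ ŝ x = g x := by
  intro r W S hP hT k R μ hμ
  obtain ⟨δ, hδ, -, K, -, hmain⟩ := sonic_char_branch_gap r W S hP hT k R μ hμ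
  refine ⟨δ, hδ, fun Λ hΛ hν hgap f g hf hg q₀ => ?_⟩
  have hU : IsOpen (Ioo (-δ) δ) := isOpen_Ioo
  have hσp : ContDiff ℝ ∞ (fun x => f x + 3 * g x) := hf.add (contDiff_const.mul hg)
  have hσq : ContDiff ℝ ∞ (fun x => f x - 3 * g x) := hf.sub (contDiff_const.mul hg)
  obtain ⟨p, q, hp, hq, hq0, hpq, -⟩ := hmain Λ hΛ hν hgap (fun x => f x + 3 * g x) (fun x => f x - 3 * g x) hσp hσq q₀
  have hdf : ∀ {φ : ℝ → ℂ}, ContDiffOn ℝ ∞ φ (Ioo (-δ) δ) → ∀ y ∈ Ioo (-δ) δ, HasDerivAt φ (deriv φ y) y :=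
    fun hφ y hy => ((hφ.differentiableOn (by simp)) y hy |>.differentiableAt (hU.mem_nhds hy)).hasDerivAt
  refine ⟨fun x => (p x + q x) / 2, fun x => (p x - q x) / 6, (hp.add hq).div_const _, (hp.sub hq).div_const _,
    by simp only; rw [hq0]; ring, fun x hx => ?_⟩
  have dw : deriv (fun x => (p x + q x) / 2) x = (deriv p x + deriv q x) / 2 :=
    (((hdf hp x hx).add (hdf hq x hx)).div_const 2).deriv
  have ds : deriv (fun x => (p x - q x) / 6) x = (deriv p x - deriv q x) / 6 :=
    (((hdf hp x hx).sub (hdf hq x hx)).div_const 6).deriv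
  refine (lin_iff_char r W S Λ (fun x => (p x + q x) / 2) (fun x => (p x - q x) / 6) (f x) (g x) x).2 ?_
  rw [dw, ds]
  obtain ⟨e1, e2⟩ := hpq x hx
  constructor
  · have : (deriv p x + deriv q x) / 2 + 3 * ((deriv p x - deriv q x) / 6) = deriv p x := by ring
    rw [this]; linear_combination e1
  · have : (deriv p x + deriv q x) / 2 - 3 * ((deriv p x - deriv q x) / 6) = deriv q x := by ring
    rw [this]; linear_combination e2

/-- **A NON-INTEGRAL EXPONENT HAS A POSITIVE GAP**: if `ν ≠ m` for every `m : ℤ` then for some `μ > 0`,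
`‖n − ν‖ ≥ μ` and `‖n + ν‖ ≥ μ` for all `n : ℕ` (finitely many `n ≤ ‖ν‖ + 1` by a minimum, the rest by the triangle
inequality). [folklore] -/
theorem exists_gap_of_forall_ne_int {ν : ℂ} (h : ∀ m : ℤ, ν ≠ (m : ℂ)) :
    ∃ μ : ℝ, 0 < μ ∧ ∀ n : ℕ, μ ≤ ‖(n : ℂ) - ν‖ ∧ μ ≤ ‖(n : ℂ) + ν‖ := by
  set N : ℕ := ⌈‖ν‖⌉₊ + 1 with hN
  set F : ℕ → ℝ := fun n => min ‖(n : ℂ) - ν‖ ‖(n : ℂ) + ν‖ with hF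
  have hFpos : ∀ n, 0 < F n := fun n => by
    refine lt_min (norm_pos_iff.2 (sub_ne_zero.2 fun e => h n ?_)) (norm_pos_iff.2 fun e => h (-(n : ℤ)) ?_)
    · rw [← e]; simp
    · have : ν = -(n : ℂ) := by linear_combination e
      rw [this]; simp
  obtain ⟨n₀, -, hmin⟩ := (Finset.range N).exists_min_image F ⟨0, by simp [hN]⟩
  refine ⟨min 1 (F n₀), lt_min one_pos (hFpos n₀), fun n => ?_⟩
  by_cases hn : n < N
  · have hle : F n₀ ≤ F n := hmin n (Finset.mem_range.2 hn)
    exact ⟨(min_le_right _ _).trans (hle.trans (min_le_left _ _)), (min_le_right _ _).trans (hle.trans (min_le_right _ _))⟩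
  · have hn' : ‖ν‖ + 1 ≤ n := by
      have h1 : ‖ν‖ ≤ ⌈‖ν‖⌉₊ := Nat.le_ceil _
      have h2 : ((⌈‖ν‖⌉₊ + 1 : ℕ) : ℝ) ≤ n := by exact_mod_cast (not_lt.1 hn)
      push_cast at h2; linarith
    have key1 : 1 ≤ ‖(n : ℂ) - ν‖ := by
      have := norm_sub_norm_le (n : ℂ) ν; rw [Complex.norm_natCast] at this; linarith
    have key2 : 1 ≤ ‖(n : ℂ) + ν‖ := by
      have := norm_sub_norm_le (n : ℂ) (-ν); rw [Complex.norm_natCast, norm_neg, sub_neg_eq_add] at this; linarith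
    exact ⟨(min_le_left _ _).trans key1, (min_le_left _ _).trans key2⟩

/-! ## From local sonic data to the global solution on the whole region -/

/-- **Registered helper `cavity_resolvent_of_local`: LOCAL SONIC DATA GIVE THE GLOBAL SOLUTION ON THE WHOLE REGION.** On the
pinned window (`r ≤ 89409/80000`), under the box package, the real-part bound and the `|Im Λ|`-confinement, for the window
rate `Λ₁` carrying a mode and `Λ` with `Re Λ ≥ −1/5` outside the `1/20`-discs around `0`, `Λ₁`, `r`: if the resolvent
equation has on some `(−δ, δ)`, `0 < δ ≤ 1`, a non-trivial `C^∞` solution of the homogeneous equations and, for the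
regular source `(f, g)`, a `C^∞` particular solution, then it has a smooth centre-regular solution on `ℝ`
(`cavity_matching_alternative`; the mode alternative is excluded by `rate_eq_of_window` and the discs). [folklore] -/
theorem cavity_resolvent_of_local : ∀ (r : ℝ) (W S : ℝ → ℝ), r ≤ 89409 / 80000 → IsMonatomicProfile r W S → CavityTube r W S → BoxPackage r W S → RealBound r W S → SonicConfinement r W S → ∀ Λ₁ : ℝ, 6 * (r - 1) < Λ₁ → Λ₁ < 9 * (r - 1) → (∃ ŵ ŝ : ℝ → ℂ, IsSmoothRadialMode r W S (Λ₁ : ℂ) ŵ ŝ) → ∀ Λ : ℂ, -(1 / 5 : ℝ) ≤ Λ.re → (1 / 20 : ℝ) ≤ ‖Λ‖ → (1 / 20 : ℝ) ≤ ‖Λ - (Λ₁ : ℂ)‖ → (1 / 20 : ℝ) ≤ ‖Λ - (r : ℂ)‖ → ∀ δ : ℝ, 0 < δ → δ ≤ 1 → (∃ ph qh : ℝ → ℂ, ContDiffOn ℝ ∞ ph (Set.Ioo (-δ) δ) ∧ ContDiffOn ℝ ∞ qh (Set.Ioo (-δ) δ) ∧ (∀ x ∈ Set.Ioo (-δ)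 δ, Λ * ph x - linW r W S ph qh x = 0 ∧ Λ * qh x - linS r W S ph qh x = 0) ∧ ∃ x ∈ Set.Ioo (-δ) δ, ph x ≠ 0 ∨ qh x ≠ 0) → ∀ (f g : ℝ → ℂ), IsRegularPair f g → (∃ pp qp : ℝ → ℂ, ContDiffOn ℝ ∞ pp (Set.Ioo (-δ) δ) ∧ ContDiffOn ℝ ∞ qp (Set.Ioo (-δ) δ) ∧ ∀ x ∈ Set.Ioo (-δ) δ, Λ * pp x - linW r W S pp qp x = f x ∧ Λ * qp x - linS r W S pp qp x = g x) → ∃ ŵ ŝ : ℝ → ℂ, IsRegularPair ŵ ŝ ∧ ∀ x, Λ * ŵ x - linW r W S ŵ ŝ x = f x ∧ Λ * ŝ x - linS r W S ŵ ŝ x = g x := by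
  intro r W S h2 hP hT hbox hre him Λ₁ h6 h9 hmode Λ hΛre hΛ0 hΛ1 hΛr δ hδ hδ1 hh f g hfg hp
  rcases cavity_matching_alternative r W S hP hT Λ δ hδ hδ1 hh f g hfg hp with hsol | ⟨ŵ, ŝ, hm⟩
  · exact hsol
  · exfalso
    have hΛ4 : -(1 / 4 : ℝ) < Λ.re := by linarith
    rcases rate_eq_of_window r W S h2 hbox hre him Λ₁ h6 h9 hmode Λ hΛ4 ⟨ŵ, ŝ, hm⟩ with h | h | h
    · rw [h, sub_self, norm_zero] at hΛ1; linarith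
    · rw [h, sub_self, norm_zero] at hΛr; linarith
    · rw [h, norm_zero] at hΛ0; linarith

/-! ## T6b: pointwise existence off the integral exponents -/

/-- **Registered helper `cavity_resolvent_pointwise_nonint` (T6b): POINTWISE EXISTENCE OF THE SMOOTH CENTRE-REGULAR
RESOLVENT SOLUTION FOR EVERY `Λ` OF THE REGION WITH NON-INTEGRAL FROBENIUS EXPONENT.** On the pinned window, under the
stub's hypotheses and for the window rate `Λ₁` carrying a smooth radial mode: for every `Λ` with `Re Λ ≥ −1/5` outside the
`1/20`-discs around `0`, `Λ₁`, `r`, whose exponent `ν(Λ) = (b₊₊(0) − Λ)/κ` is not an integer, and every regular source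
`(f, g)`, the resolvent equation `Λŵ − linW = f`, `Λŝ − linS = g` has a smooth centre-regular solution on `ℝ` (gap from
`exists_gap_of_forall_ne_int`, local data from `sonic_smooth_branch_gap` with `k = ⌈Re ν⌉ + 1`, `R = ‖Λ‖`, assembly by
`cavity_resolvent_of_local`). The hypotheses `17307/15625 ≤ r` and `OrigProfileEqs` are carried for uniformity with
`cavity_resolvent_pointwise_offaxis` but not used. [folklore] -/
theorem cavity_resolvent_pointwise_nonint : ∀ (r : ℝ) (W S : ℝ → ℝ), (17307 / 15625 : ℝ) ≤ r → r ≤ 697 / 625 → IsMonatomicProfile r W S → OrigProfileEqs r W S → CavityTube r W S → BoxPackage r W S → RealBound r W S → SonicConfinement r W S → ∀ Λ₁ : ℝ, 6 * (r - 1) < Λ₁ → Λ₁ < 9 * (r - 1) → (∃ ŵ ŝ : ℝ → ℂ, IsSmoothRadialMode r W S (Λ₁ : ℂ) ŵ ŝ) → ∀ Λ : ℂ, -(1 / 5 : ℝ) ≤ Λ.re → (1 / 20 : ℝ) ≤ ‖Λ‖ → (1 / 20 : ℝ) ≤ ‖Λ - (Λ₁ : ℂ)‖ → (1 / 20 : ℝ)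 ≤ ‖Λ - (r : ℂ)‖ → (∀ m : ℤ, ((((2 / 3 * deriv W 0 + 2 * deriv S 0 + 2 * W 0 + 4 * S 0 - r : ℝ) : ℂ) - Λ) / ((-(deriv W 0 + deriv S 0) : ℝ) : ℂ)) ≠ (m : ℂ)) → ∀ (f g : ℝ → ℂ), IsRegularPair f g → ∃ ŵ ŝ : ℝ → ℂ, IsRegularPair ŵ ŝ ∧ ∀ x, Λ * ŵ x - linW r W S ŵ ŝ x = f x ∧ Λ * ŝ x - linS r W S ŵ ŝ x = g x := by
  intro r W S _ h2 hP _ hT hbox hre him Λ₁ h6 h9 hmode Λ hΛre hΛ0 hΛ1 hΛr hνZ f g hfg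
  have h2' : r ≤ 89409 / 80000 := h2.trans (by norm_num)
  set ν : ℂ := ((((2 / 3 * deriv W 0 + 2 * deriv S 0 + 2 * W 0 + 4 * S 0 - r : ℝ) : ℂ) - Λ) /
    ((-(deriv W 0 + deriv S 0) : ℝ) : ℂ)) with hν
  obtain ⟨μ, hμ, hgap⟩ := exists_gap_of_forall_ne_int hνZ
  obtain ⟨k, hk⟩ : ∃ k : ℕ, ν.re ≤ (k : ℝ) - 1 :=
    ⟨⌈ν.re⌉₊ + 1, by push_cast; linarith [Nat.le_ceil ν.re]⟩
  obtain ⟨δ₀, hδ₀, hloc⟩ := sonic_smooth_branch_gap r W S hP hT k ‖Λ‖ μ hμ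
  obtain ⟨ph, qh, hph, hqh, hq1, hsolh⟩ := hloc Λ le_rfl hk hgap (fun _ => 0) (fun _ => 0) contDiff_const contDiff_const 1
  obtain ⟨pp, qp, hpp, hqp, -, hsolp⟩ := hloc Λ le_rfl hk hgap f g hfg.1 hfg.2.1 0
  set δ : ℝ := min δ₀ 1 with hδ
  have hδpos : 0 < δ := lt_min hδ₀ one_pos
  have hsub : Ioo (-δ) δ ⊆ Ioo (-δ₀) δ₀ := Ioo_subset_Ioo (neg_le_neg (min_le_left _ _)) (min_le_left _ _)
  have hne0 : ph 0 ≠ 0 ∨ qh 0 ≠ 0 := by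
    by_contra h
    push Not at h
    rw [h.1, h.2, mul_zero, sub_zero] at hq1
    exact zero_ne_one hq1
  exact cavity_resolvent_of_local r W S h2' hP hT hbox hre him Λ₁ h6 h9 hmode Λ hΛre hΛ0 hΛ1 hΛr δ hδpos
    (min_le_right _ _) ⟨ph, qh, hph.mono hsub, hqh.mono hsub, fun x hx => hsolh x (hsub hx), 0, ⟨by linarith, hδpos⟩,
    hne0⟩ f g hfg ⟨pp, qp, hpp.mono hsub, hqp.mono hsub, fun x hx => hsolp x (hsub hx)⟩

end Summit.AtomisticToContinuum.HydrodynamicLimit.Theorems.SonicCavityRenewal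

end
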